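import Mathlib
import HarnessLib
import Summits.Langlands.Langlands.Statement
import Literature.NumberTheory.Automorphic.HLTTCompatible
import Literature.NumberTheory.Automorphic.AlgebraicityTwist
import Literature.NumberTheory.Automorphic.AutomorphicTwistNorm
import Literature.NumberTheory.Automorphic.AutomorphicRepsGLSatakeFlathProofs

/-!
# Route `RamifiedCoefficientSeed`, crux `AdjointLiftingGL3` (stmt-Langlands-16779), line `birth`:
# stub `stub_untwist` — from Harris–Lan–Taylor–Thorne's normalisation to the summit's

The `|det|` bookkeeping of the line.  ACC+ Thm. 6.1.1 (stub `stub_automorphyLifting`) hands over a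
cuspidal automorphic representation `Π` of `GL₃(𝔸_ℚ)` of WEIGHT ZERO together with HLTT's
characterising property `HLTT.IsCompatible Π ι ρ` of `r_ι(Π)` for the given `ρ : Γ_ℚ → GL₃(ℚ̄_p)`:
for every rational prime `q ≠ p` above which `Π` is unramified and every place `v ∣ q`, `ρ` is
unramified at `v` with `charpoly ρ(Frob_v) = ∏_j (X − ι⁻¹((q_v α_j)⁻¹))` for every Satake parameter
`α` of `Π` at `v` (shift `(√q_v)^{3-1} = q_v`, `arithFrobPolyOfSatake ι q_v 3 α`).  The summit
(`Summit.Langlands.SatakeFrobCompatibleAt`) asks for an L-ALGEBRAIC `π` matched with `ρ` in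
Buzzard–Gee's normalisation `arithFrobPolyOfSatake ι q_v 1` at all but finitely many places.

Proof (this file, everything proved; no named fact):
* `π := Π ⊗ |det|_𝔸⁻¹` (`CuspidalAutomorphicRepData.exists_twist_hasInfinityType Π (-1)`), of
  infinity type the weight-zero type `{(1,-1),(0,0),(-1,1)}` shifted by `-1`, which is
  L-algebraic (`isLAlgebraic_weightZeroInfinityType_three_twist_neg_one`: the weight-zero type is
  C-algebraic, `isRegularAlgebraic_weightZeroInfinityType`, and `(3-1)/2 + (-2) = -1`);
* its Satake parameters are `q_v · α`
  (`AutomorphicRepData.HasSatakeParamAt.of_map_mulChar_detTwist_of_cpow`), and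
  `arithFrobPolyOfSatake ι q 1 (q · α) = arithFrobPolyOfSatake ι q 3 α`
  (`arithFrobPolyOfSatake_one_twist_of_three`, `(√q)² = q = q^{-(-1)}`);
* "all but finitely many places": `Π` is unramified at all but finitely many places (Flath,
  `AutomorphicRepData.hasSatakeParamAt_cofinite_holds`), hence unramified ABOVE all but finitely
  many rational primes (`HLTT.isUnramifiedAbove_cofinite`), and the rational prime below a place,
  `v ↦ Ideal.absNorm (v.asIdeal.under ℤ)`, tends to the cofinite filter
  (`tendsto_absNorm_under_asIdeal_cofinite`: finitely many places above a rational prime,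
  `Ideal.finite_factors`), so at all but finitely many `v` the prime `q` below `v` is `≠ p` with
  `Π` unramified above `q`, and `HLTT.IsCompatible.isGaloisCompatibleAt` applies.

References: Harris–Lan–Taylor–Thorne, Res. Math. Sci. 3:37 (2016), Thm. A (the `|det|^{(1-n)/2}`
normalisation); Buzzard–Gee, *The conjectural connections between automorphic representations and
Galois representations* (2014), Conj. 3.2.1 and §5.3 (L-normalisation, `C ↔ L` by `|det|^{(n-1)/2}`).
-/

set_option linter.dupNamespace false

noncomputable section

namespace Summit.Langlands.Langlands.Cruxes.AdjointLiftingGL3.Birth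

open scoped MatrixGroups NumberField
open NumberField IsDedekindDomain Field Filter
open Literature.NumberTheory.GaloisRepresentations Literature.NumberTheory.PAdicHodge
open Literature.NumberTheory.Automorphic

/-! ## Normalisations: `(√q)² = q` and the Frobenius-polynomial identity `m = 3 ↔ m = 1` -/

/-- **`m = 3` for `α` is `m = 1` for `q α`**: the Satake parameter `q^{-s} α`, `s = -1`, of
`Π ⊗ |det|⁻¹` in Buzzard–Gee's `L`-normalisation (`arithFrobPolyOfSatake ι q 1`) predicts the same
characteristic polynomial of arithmetic Frobenius as the Satake parameter `α` of the weight-zero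
`Π` in the Harris–Lan–Taylor–Thorne normalisation (`arithFrobPolyOfSatake ι q 3`, shift
`(√q)^{3-1} = q`). [cite: BuzzardGeeLMS2014, §5.3] -/
theorem arithFrobPolyOfSatake_one_twist_of_three {ℓ : ℕ} [Fact ℓ.Prime] (ι : PadicAlgCl ℓ ≃+* ℂ)
    (q : ℕ) (α : Multiset ℂ) :
    arithFrobPolyOfSatake ι q 1 (α.map (((q : ℂ) ^ (-(((-1 : ℝ) : ℝ) : ℂ))) * ·)) =
      arithFrobPolyOfSatake ι q 3 α := by
  have hsq2 : ((Real.sqrt (q : ℝ) : ℝ) : ℂ) ^ (3 - 1) = (q : ℂ) := by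
    rw [show (3 - 1 : ℕ) = 2 from rfl, ← Complex.ofReal_pow, Real.sq_sqrt (Nat.cast_nonneg _),
      Complex.ofReal_natCast]
  simp only [arithFrobPolyOfSatake, Multiset.map_map, Function.comp_def]
  congr 1
  refine Multiset.map_congr rfl fun a _ => ?_
  rw [show (1 - 1 : ℕ) = 0 from rfl, pow_zero, one_mul, Complex.ofReal_neg, Complex.ofReal_one,
    neg_neg, Complex.cpow_one, hsq2]

/-! ## The twisted infinity type is L-algebraic -/

/-- **The weight-zero infinity type of `GL₃` twisted by `|det|⁻¹` is L-algebraic**: its weights are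
`(ρ_i - 1, -ρ_i - 1) = (-i, i - 2)`, `i = 0, 1, 2`, all integral — the weight-zero type is
C-algebraic (`isRegularAlgebraic_weightZeroInfinityType`), so its twist by `(3-1)/2 = 1` is
L-algebraic (Buzzard–Gee), and so is the further twist by the integer `-2`; `1 + (-2) = -1`.
[cite: BuzzardGeeLMS2014, §5.3] -/
theorem isLAlgebraic_weightZeroInfinityType_three_twist_neg_one (K : Type*) [Field K] :
    ((weightZeroInfinityType 3 K).twist (((-1 : ℝ) : ℝ) : ℂ)).IsLAlgebraic := by
  have h1 := ((InfinityType.isCAlgebraic_iff_isLAlgebraic_twist _).mp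
    (isRegularAlgebraic_weightZeroInfinityType 3 K).1).twist_intCast (-2)
  rw [InfinityType.twist_twist] at h1
  convert h1 using 2
  push_cast
  ring

/-! ## Places: the rational prime below a finite place tends to the cofinite filter -/

/-- **Only finitely many places of a number field lie above a given rational prime**, in filter
form: the rational prime below a finite place, `v ↦ Ideal.absNorm (v.asIdeal.under ℤ)` (Mathlib
`Int.absNorm_under_mem`, `Nat.absNorm_under_prime`), tends to the cofinite filter along the
cofinite filter — its fibre over `q ≠ 0` is contained in the finite set of prime factors of `(q)`
(`Ideal.finite_factors`), and its fibre over `0` is empty (the prime below is prime). [folklore] -/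
theorem tendsto_absNorm_under_asIdeal_cofinite (K : Type) [Field K] [NumberField K] :
    Tendsto (fun v : HeightOneSpectrum (𝓞 K) ↦ Ideal.absNorm (v.asIdeal.under ℤ))
      cofinite cofinite := by
  refine Filter.Tendsto.cofinite_of_finite_preimage_singleton fun q => Set.finite_coe_iff.mpr ?_
  rcases Nat.eq_zero_or_pos q with rfl | hq
  · refine Set.finite_empty.subset ?_
    intro v (hv : Ideal.absNorm (v.asIdeal.under ℤ) = 0)
    haveI : NeZero v.asIdeal := ⟨v.ne_bot⟩
    exact ((Nat.absNorm_under_prime v.asIdeal).ne_zero hv).elim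
  · have hI : Ideal.span {((q : ℕ) : 𝓞 K)} ≠ ⊥ := by
      rw [Ne, Ideal.span_singleton_eq_bot]
      exact_mod_cast hq.ne'
    refine (Ideal.finite_factors hI).subset ?_
    intro v (hv : Ideal.absNorm (v.asIdeal.under ℤ) = q)
    have hmem := Int.absNorm_under_mem v.asIdeal
    rw [hv] at hmem
    exact Ideal.dvd_span_singleton.mpr hmem

/-! ## The stub -/

/-- **STUB D — untwisting HLTT's normalisation** (from `ρ ≅ r_ι(Π)`, `Π` of weight zero, to the
summit's L-algebraic Satake–Frobenius matching).  Let `Π` be a cuspidal automorphic representation of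
`GL₃(𝔸_ℚ)` of weight zero and `ρ : Γ_ℚ → GL₃(ℚ̄_p)` a framed representation with HLTT's
characterising property of `r_ι(Π)` (at every place `v` over a rational prime `q ≠ p` above which `Π`
is unramified: `ρ` unramified with `charpoly ρ(Frob_v) = ∏_j (X − ι⁻¹((q_v α_j)⁻¹))`, `α` any Satake
parameter of `Π` at `v`, shift `q_v^{(n-1)/2} = q_v`).  Then there is a cuspidal L-ALGEBRAIC `π` of
`GL₃(𝔸_ℚ)` — namely `π = Π ⊗ |det|_𝔸⁻¹`, Satake parameters `q_v · α`
(`CuspidalAutomorphicRepData.exists_twist_hasInfinityType`,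
`AutomorphicRepData.HasSatakeParamAt.of_map_mulChar_detTwist_of_cpow`), infinity type the weight-zero
type `{(1,-1),(0,0),(-1,1)}` shifted by `-1`, integral
(`isLAlgebraic_weightZeroInfinityType_three_twist_neg_one`) — which is Satake–Frobenius compatible
with `ρ` in the summit's normalisation (`arithFrobPolyOfSatake ι q_v 1`,
`arithFrobPolyOfSatake_one_twist_of_three`) at all but finitely many places: `Π` is unramified at
all but finitely many places (Flath, `AutomorphicRepData.hasSatakeParamAt_cofinite_holds`), hence
above all but finitely many rational primes (`HLTT.isUnramifiedAbove_cofinite`), and the prime below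
a place tends to the cofinite filter (`tendsto_absNorm_under_asIdeal_cofinite`).  It is the
`|det|^{(n-1)/2}` bookkeeping every consumer of HLTT's `r_ι` performs.
[cite: HarrisLanTaylorThorneRMS2016, Thm. A] [cite: BuzzardGeeLMS2014, Conj. 3.2.1 and §5.3] -/
theorem stub_untwist :
    ∀ (p : ℕ) [Fact p.Prime] (hcpt : isCompact_glFiniteIntegralLevel 3 ℚ) (ι : PadicAlgCl p ≃+* ℂ)
      (ρ : FramedGaloisRep ℚ (PadicAlgCl p) 3) (Pi : CuspidalAutomorphicRepData 3 ℚ hcpt),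
      Pi.1.HasWeightZero → HLTT.IsCompatible Pi.1 ι ρ →
        ∃ π : CuspidalAutomorphicRepData 3 ℚ hcpt, π.1.IsLAlgebraic ∧
          ∀ᶠ v : HeightOneSpectrum (𝓞 ℚ) in cofinite,
            Summit.Langlands.SatakeFrobCompatibleAt ι π.1 ρ v := by
  intro p _ hcpt ι ρ Pi hw0 hcompat
  haveI : NeZero (3 : ℕ) := ⟨by norm_num⟩
  -- the twist `π := Π ⊗ |det|_𝔸⁻¹`, of infinity type `(weight zero).twist (-1)`
  obtain ⟨χ, π, hχ, hW, hW', hT⟩ := Pi.exists_twist_hasInfinityType (-1 : ℝ) hw0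
  refine ⟨π, ⟨_, hT, isLAlgebraic_weightZeroInfinityType_three_twist_neg_one ℚ⟩, ?_⟩
  -- `Π` is unramified above all but finitely many rational primes, and the prime below `v`
  -- avoids any finite set of rational primes (and `p`) for all but finitely many `v`
  have hbelow := tendsto_absNorm_under_asIdeal_cofinite ℚ
  have hcof := AutomorphicRepData.hasSatakeParamAt_cofinite_holds Pi.1
  filter_upwards [hbelow.eventually (HLTT.isUnramifiedAbove_cofinite Pi.1 hcof),
    hbelow.eventually (eventually_cofinite_ne p), hcof] with v hv1 hv2 hv3
  haveI : NeZero v.asIdeal := ⟨v.ne_bot⟩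
  have hq : (Ideal.absNorm (v.asIdeal.under ℤ)).Prime := Nat.absNorm_under_prime v.asIdeal
  have hqv : ((Ideal.absNorm (v.asIdeal.under ℤ) : ℕ) : 𝓞 ℚ) ∈ v.asIdeal :=
    Int.absNorm_under_mem v.asIdeal
  -- a Satake parameter `α` of `Π` at `v` (Flath), HLTT-compatibility at `v`, and the twist
  obtain ⟨α, hα⟩ := hv3
  obtain ⟨hur, hpoly⟩ := hcompat.isGaloisCompatibleAt hq hv2 (hv1 hq) hqv α hα
  exact ⟨_, hα.of_map_mulChar_detTwist_of_cpow hχ hW hW', hur,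
    by rwa [arithFrobPolyOfSatake_one_twist_of_three]⟩

end Summit.Langlands.Langlands.Cruxes.AdjointLiftingGL3.Birth

end
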